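import Literature.Geometry.Lorentzian.DataEmbeddingNormalSmooth
import Literature.Geometry.Lorentzian.HypersurfaceNaturality
import Literature.Geometry.Lorentzian.CauchyDevelopmentRestrict
import Literature.Geometry.Lorentzian.CauchyDevelopmentOneJet
import Literature.Geometry.Lorentzian.CommonDevelopmentEmbedding
import Literature.Geometry.Lorentzian.IsometryProofs
import Literature.Topology.FourManifolds.ImmersionCriterion
import HarnessLib

/-!
# Pushing a data embedding forward along an isometric open embedding of its spacetime
# (Sbierski 2016, Def. 2.3; Choquet-Bruhat–Geroch 1969, p. 330)

Let `𝒮 = (M, g, τ, ι, ν)` be a data embedding of the initial data set `D` on `X`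
(`DataEmbedding`, `CauchyDevelopment.lean`) and let `χ : M → M'` be a smooth, time-orientation
preserving, isometric OPEN EMBEDDING into another spacetime `𝒯 = (M', g', τ')` of the same
dimension. Then **`(M', g', τ', χ ∘ ι, dχ ν)` is again a data embedding of `D`**
(`DataEmbedding.mapAlong`): `χ ∘ ι` is a smooth embedding (an injective-differential immersion,
`isImmersion_of_injective_mfderiv`, composed of topological embeddings); `dχ ν` is the future unit
normal (`χ` is isometric and preserves the time orientation); the induced metric is
`(χ ∘ ι)^* g' = ι^* (χ^* g') = ι^* g = h` and the second fundamental form is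
`K^{g'}_{χ ∘ ι, dχ ν} = K^{χ^* g'}_{ι, ν} = K^{g}_{ι, ν} = k` (naturality of the shape tensor under
the local isometry `χ`, `PseudoRiemannianMetric.secondFundamentalForm_comap`, O'Neill 1983, Ch. 3,
Prop. 3.59 with Ch. 4, Lemma 4.4; the normal `ν` is smooth along `ι`,
`DataEmbedding.mdifferentiableAt_embed_normal`). By construction `𝒮` embeds into its push-forward
(`embedsInto_mapAlong`), which is vacuum iff `Ric(g') = 0` (`mapAlong_isVacuum`).

This is the operation "regard the development `𝒮` as sitting inside `M'`" used when a local
development constructed in a chart is transported back to the spacetime (Sbierski 2016, §3.2,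
proof of Thm. 12) — the same bookkeeping as `ChainUnionDataEmbedding.chainDataEmbedding` (the
canonical maps into a direct limit) and `DevelopmentGluing.gluedDataEmbedding`, for a single map.

Everything is proved; the only definition is the pushed-forward data embedding; no named facts.

## References

* J. Sbierski, Ann. Henri Poincaré 17 (2016) 301–329 = arXiv:1309.7591, Def. 2.2–2.3 and §3.2.
* Y. Choquet-Bruhat, R. Geroch, Comm. Math. Phys. 14 (1969) 329–335, p. 330 ("extension").
* B. O'Neill, *Semi-Riemannian geometry with applications to relativity*, 1983, Ch. 3, p. 58,
  pp. 90–91, Prop. 3.59; Ch. 4, Lemma 4.4.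
* H. Ringström, *The Cauchy Problem in General Relativity*, EMS 2009, Def. 16.2, 16.5.
-/

noncomputable section

open Bundle Set Function Filter TopologicalSpace Manifold Topology
open scoped Manifold ContDiff Topology

namespace Literature.Geometry.Lorentzian

universe u

section Developments

variable {n : ℕ} {X : Type u} [TopologicalSpace X] [ChartedSpace (EuclideanSpace ℝ (Fin n)) X]
  [IsManifold (𝓡 n) ∞ X] [ConnectedSpace X] {D : InitialDataSet (𝓡 n) X}

namespace DataEmbedding

variable (𝒮 : DataEmbedding D) (𝒯 : Spacetime.{u} (n + 1)) {χ : 𝒮.carrier → 𝒯.carrier}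
  (hχo : IsOpenEmbedding χ)
  (hχi : 𝒮.metric.IsIsometricImmersion 𝒯.metric.toPseudoRiemannianMetric χ)
  (hχτ : 𝒮.timeOrientation.PreservesTimeOrientation χ 𝒯.timeOrientation)

/-! ### Bookkeeping for an isometric immersion of the spacetime -/

variable {𝒮 𝒯}

/-- The isometry identity `g'(dχ u, dχ w) = g(u, w)`, applied. O'Neill 1983, Ch. 3, p. 58.
[cite: ONeillSemiRiemannian1983, Ch. 3, p. 58] -/
theorem val_mfderiv_of_isIsometricImmersion
    (hχi : 𝒮.metric.IsIsometricImmersion 𝒯.metric.toPseudoRiemannianMetric χ) (x : 𝒮.carrier)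
    (u w : TangentSpace (𝓡 (n + 1)) x) :
    𝒯.metric.val (χ x) (mfderiv (𝓡 (n + 1)) (𝓡 (n + 1)) χ x u)
      (mfderiv (𝓡 (n + 1)) (𝓡 (n + 1)) χ x w) = 𝒮.metric.val x u w := by
  have h := DFunLike.congr_fun (DFunLike.congr_fun (hχi.2 x) u) w
  rw [pullbackBilin_apply] at h
  exact h

/-- An isometric immersion between equidimensional spacetimes has injective differentials
(`LorentzianMetric.isInvertible_mfderiv_of_isIsometricImmersion`). O'Neill 1983, Ch. 3, p. 58.
[cite: ONeillSemiRiemannian1983, Ch. 3, p. 58] -/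
theorem injective_mfderiv_of_isIsometricImmersion
    (hχi : 𝒮.metric.IsIsometricImmersion 𝒯.metric.toPseudoRiemannianMetric χ) (x : 𝒮.carrier) :
    Injective (mfderiv (𝓡 (n + 1)) (𝓡 (n + 1)) χ x) :=
  (LorentzianMetric.isInvertible_mfderiv_of_isIsometricImmersion hχi x).injective

/-- An isometric immersion is `C^{∞ + 1} = C^∞` (the regularity asked by
`PseudoRiemannianMetric.comap`). [folklore] -/
theorem contMDiff_add_one_of_isIsometricImmersion
    (hχi : 𝒮.metric.IsIsometricImmersion 𝒯.metric.toPseudoRiemannianMetric χ) :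
    ContMDiff (𝓡 (n + 1)) (𝓡 (n + 1)) (∞ + 1) χ := by
  have h : ((∞ : ℕ∞ω) + 1) = ∞ := rfl
  rw [h]
  exact hχi.1

/-- **The pullback of `g'` along the isometric immersion `χ` is `g`** (as pseudo-Riemannian
metrics: `PseudoRiemannianMetric.comap` along `χ` versus the metric of `𝒮`). O'Neill 1983, Ch. 3,
pp. 90–91. [cite: ONeillSemiRiemannian1983, Ch. 3, pp. 90–91] -/
theorem comap_eq_of_isIsometricImmersion
    (hχi : 𝒮.metric.IsIsometricImmersion 𝒯.metric.toPseudoRiemannianMetric χ) :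
    𝒯.metric.toPseudoRiemannianMetric.comap PseudoRiemannianMetric.contMDiff_pullbackBilin_holds χ
        (contMDiff_add_one_of_isIsometricImmersion hχi)
        (injective_mfderiv_of_isIsometricImmersion hχi) rfl =
      𝒮.metric.toPseudoRiemannianMetric :=
  PseudoRiemannianMetric.ext (funext hχi.2)

/-- Chain rule for `χ ∘ ι`. [folklore] -/
theorem mfderiv_comp_embed_apply'
    (hχi : 𝒮.metric.IsIsometricImmersion 𝒯.metric.toPseudoRiemannianMetric χ) (x : X)
    (v : TangentSpace (𝓡 n) x) :
    mfderiv (𝓡 n) (𝓡 (n + 1)) (χ ∘ 𝒮.embed) x v =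
      mfderiv (𝓡 (n + 1)) (𝓡 (n + 1)) χ (𝒮.embed x) (mfderiv (𝓡 n) (𝓡 (n + 1)) 𝒮.embed x v) := by
  rw [mfderiv_comp x ((hχi.1 _).mdifferentiableAt (by simp)) (𝒮.mdifferentiable_embed x)]
  rfl

variable (𝒮 𝒯)

/-! ### The pushed-forward data embedding -/

/-- **Push-forward of a data embedding along an isometric open embedding of its spacetime.** For
a data embedding `𝒮 = (M, g, τ, ι, ν)` of `D` and a smooth, time-orientation preserving, isometric
open embedding `χ : M → M'` into a spacetime `𝒯 = (M', g', τ')` of the same dimension, the data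
embedding `(M', g', τ', χ ∘ ι, dχ ν)` of `D`: `χ ∘ ι` is a smooth embedding, `dχ ν` its future unit
normal, `(χ ∘ ι)^* g' = ι^* g = h`, and `K^{g'}_{χ∘ι, dχ ν} = K^{g}_{ι, ν} = k` by naturality of
the shape tensor under the local isometry `χ` (`PseudoRiemannianMetric.secondFundamentalForm_comap`;
O'Neill 1983, Ch. 3, Prop. 3.59, Ch. 4, Lemma 4.4). Sbierski 2016, Def. 2.3 ("`M'` is an
extension of `M`": the data embedded by `ψ ∘ ι`); Choquet-Bruhat–Geroch 1969, p. 330.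
[cite: Sbierski2016AHP, §2, Def. 2.3] -/
def mapAlong : DataEmbedding D where
  toSpacetime := 𝒯
  embed := χ ∘ 𝒮.embed
  isSmoothEmbedding := by
    have hc : ContMDiff (𝓡 n) (𝓡 (n + 1)) ∞ (χ ∘ 𝒮.embed) :=
      hχi.1.comp 𝒮.isSmoothEmbedding.contMDiff
    refine ⟨Literature.Topology.FourManifolds.isImmersion_of_injective_mfderiv hc (by simp)
      fun x ↦ ?_, hχo.isEmbedding.comp 𝒮.isSmoothEmbedding.isEmbedding⟩
    intro v w h
    rw [mfderiv_comp_embed_apply' hχi, mfderiv_comp_embed_apply' hχi] at h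
    exact 𝒮.mfderiv_embed_injective x (injective_mfderiv_of_isIsometricImmersion hχi _ h)
  normal := fun x ↦ mfderiv (𝓡 (n + 1)) (𝓡 (n + 1)) χ (𝒮.embed x) (𝒮.normal x)
  isFutureUnitNormal := by
    refine ⟨⟨fun y v ↦ ?_, fun y ↦ ?_⟩, fun y ↦ ?_⟩
    · change 𝒯.metric.val (χ (𝒮.embed y))
        (mfderiv (𝓡 (n + 1)) (𝓡 (n + 1)) χ (𝒮.embed y) (𝒮.normal y))
        (mfderiv (𝓡 n) (𝓡 (n + 1)) (χ ∘ 𝒮.embed) y v) = 0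
      rw [mfderiv_comp_embed_apply' hχi, val_mfderiv_of_isIsometricImmersion hχi]
      exact 𝒮.isFutureUnitNormal.1.1 y v
    · change 𝒯.metric.val (χ (𝒮.embed y))
        (mfderiv (𝓡 (n + 1)) (𝓡 (n + 1)) χ (𝒮.embed y) (𝒮.normal y))
        (mfderiv (𝓡 (n + 1)) (𝓡 (n + 1)) χ (𝒮.embed y) (𝒮.normal y)) = -1
      rw [val_mfderiv_of_isIsometricImmersion hχi]
      exact 𝒮.isFutureUnitNormal.1.2 y
    · exact hχτ.isFutureDirected_mfderiv hχi.2 (𝒮.isFutureUnitNormal.2 y)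
  induced_h := fun y ↦ by
    rw [pullbackBilin_comp (hχi.1.mdifferentiable (by simp)) 𝒮.mdifferentiable_embed,
      funext hχi.2]
    exact 𝒮.induced_h y
  induced_k := by
    intro inst y
    haveI hLC : 𝒮.metric.toPseudoRiemannianMetric.HasLeviCivita :=
      𝒮.metric.toPseudoRiemannianMetric.hasLeviCivita
    haveI hgcLC : (𝒯.metric.toPseudoRiemannianMetric.comap
        PseudoRiemannianMetric.contMDiff_pullbackBilin_holds χ
        (contMDiff_add_one_of_isIsometricImmersion hχi)
        (injective_mfderiv_of_isIsometricImmersion hχi) rfl).HasLeviCivita :=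
      PseudoRiemannianMetric.hasLeviCivita _
    have key := PseudoRiemannianMetric.secondFundamentalForm_comap
      𝒯.metric.toPseudoRiemannianMetric PseudoRiemannianMetric.contMDiff_pullbackBilin_holds
      (Φ := χ) (contMDiff_add_one_of_isIsometricImmersion hχi)
      (injective_mfderiv_of_isIsometricImmersion hχi) rfl
      (f := 𝒮.embed) (ν := 𝒮.normal) (y := y) BoundarylessManifold.isInteriorPoint
      (𝒮.mdifferentiableAt_embed_normal y)
    change 𝒯.metric.toPseudoRiemannianMetric.secondFundamentalForm (𝓡 n) (χ ∘ 𝒮.embed)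
      (fun x ↦ mfderiv (𝓡 (n + 1)) (𝓡 (n + 1)) χ (𝒮.embed x) (𝒮.normal x)) y = D.kBilin y
    rw [← key, PseudoRiemannianMetric.secondFundamentalForm_congr_metric
      (comap_eq_of_isIsometricImmersion hχi) hgcLC hLC]
    exact 𝒮.induced_k y

/-- The spacetime of the pushed-forward data embedding is the target spacetime. [folklore] -/
@[simp]
theorem mapAlong_toSpacetime : (𝒮.mapAlong 𝒯 hχo hχi hχτ).toSpacetime = 𝒯 := rfl

/-- The embedding of the pushed-forward data embedding is `χ ∘ ι`. [folklore] -/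
@[simp]
theorem mapAlong_embed : (𝒮.mapAlong 𝒯 hχo hχi hχτ).embed = χ ∘ 𝒮.embed := rfl

/-- The normal of the pushed-forward data embedding is `dχ ν`. [folklore] -/
@[simp]
theorem mapAlong_normal :
    (𝒮.mapAlong 𝒯 hχo hχi hχτ).normal =
      fun x ↦ mfderiv (𝓡 (n + 1)) (𝓡 (n + 1)) χ (𝒮.embed x) (𝒮.normal x) := rfl

/-- **`𝒮` embeds into its push-forward**, by `χ` itself. Sbierski 2016, Def. 2.3; Ringström 2009,
Def. 16.5. [cite: Sbierski2016AHP, §2, Def. 2.3] -/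
theorem embedsInto_mapAlong : 𝒮.EmbedsInto (𝒮.mapAlong 𝒯 hχo hχi hχτ) :=
  ⟨χ, hχi.1, hχo, hχi, hχτ, rfl⟩

/-- The push-forward is vacuum iff the target metric is Ricci-flat (for every proof of the standing
Levi-Civita hypothesis). Ringström 2009, Def. 16.3. [cite: Ringstrom2009, Def. 16.3] -/
theorem mapAlong_isVacuum
    (h : ∀ [𝒯.metric.toPseudoRiemannianMetric.HasLeviCivita],
      𝒯.metric.toPseudoRiemannianMetric.IsRicciFlat) :
    (𝒮.mapAlong 𝒯 hχo hχi hχτ).IsVacuum := by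
  intro inst
  haveI : 𝒯.metric.toPseudoRiemannianMetric.HasLeviCivita := inst
  exact h

end DataEmbedding

end Developments

end Literature.Geometry.Lorentzian

end
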